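import Summits.QuantumAdvantage.QuantumAdvantage.Theorems.ResponseDialC

/-! # ResponseDialD — part 4/5 (mechanical split for landing of `ResponseDial`; content verbatim; scopes re-opened with their variables) -/

set_option linter.dupNamespace false
noncomputable section
open scoped Classical

namespace Summit.QuantumAdvantage.QuantumAdvantage.Theorems.ResponseDial
open Finset
open Literature.Computability.QuantumComplexity Literature.Computability.QuantumComplexity.RingHLF
open Literature.Computability.MetaComplexity Literature.Computability.MetaComplexity.Smolensky
open Summit.QuantumAdvantage.AdviceFreeQNC0
open Summit.QuantumAdvantage.QuantumAdvantage.Theorems.AnchorDial (outB dev cN orbF orbL orbL_cons fz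
  cN_orbF_cast oddZeros_orbF win_iff gCond_iff_cN card_filter_orbF orbF_false flip2 card_odd_ge loss_shape_mono)
open Summit.QuantumAdvantage.QuantumAdvantage.Theorems.AnchorDial.Core (ct sg)
open Summit.QuantumAdvantage.QuantumAdvantage.Theorems.HolonomyDial (gCond tPoly tPoly_apply tPoly_mem card_odd_le
  xorP xorP_mem xorP_apply_bool mono_singleton_apply indP indP_mem indP_apply)
open Summit.QuantumAdvantage.QuantumAdvantage.Theorems.StabilizerDial (apIdx apStrat apStrat_mem bitP bitP_apStrat
  pad rel_pad_iff outB_pad_zero pad_mem StabFew rowMask bitP_pad mem_dev_pad_apStrat_iff BlockRec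
  blockSelect_of_fewLocus goodBound_of_blockRec fibreIdentityAt_of_block oddSliceBound_holds eventually_polylog
  side_bounds)
open Summit.QuantumAdvantage.QuantumAdvantage.Theorems.LocusDial (Coverable FewLocus)
open Summit.QuantumAdvantage.QuantumAdvantage.Theorems.SparsityDial (real_loss_of_frac AntipodalLoss3 stabFew_mono_mr
  one_le_logpow)
open Summit.QuantumAdvantage.QuantumAdvantage.Theses.SparsityDial (DenseGenericLoss3)

/-! ## §7  A CERTIFIED MEMBER of the residual's class: the HALF-COUNTER family.

`hcStrat`: the antipodal pointer on the first half `[1, N/2)`, and on the rest the canonical guess toggled by the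
COMMON mod-3 counter `q(x) = [#{odd i : x_i} ≡ 0 (mod 3)]` (degree 4).  (a) It is NOT cheaply polylog-sparsifiable — the
tree's E1 certificate examines first-half blocks only, so it transfers to every family agreeing with `apStrat` there
(`not_polylogSparse_of_agree`).  (b) Its response along EVERY admissible 5-orbit at EVERY input is non-additive
(`hcStrat_not_addResp`): the additive-response law is silent on it; neither does the frozen-deviation law (`frozen16`)
speak (every pair flip moves the counter).  Its loss is OPEN: the residual's first rung `HalfCounterLoss3`. -/

section Agree
variable {N : ℕ}

/-- `blockSelect_of_fewLocus` for ANY family whose padded deviation indicator agrees with the antipodal one on the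
first half `[1, N/2)` (hypothesis `hdev`); the tree proof verbatim but for the one dev-membership step. -/
theorem blockSelect_of_fewLocus_agree (m r k N : ℕ) (P : Fin N → CubeFn (ZMod 3) N) (s : Fin N → CubeFn (ZMod 3) N)
    (hdev : ∀ (x : Fin N → Bool) (j : Fin N), 1 ≤ j.val → j.val < N / 2 →
      (j ∈ dev (pad P s) x ↔ rowMask s x j ≠ x (apIdx j)))
    (hF : FewLocus m r (pad P s)) (hk : 2 * k + 4 ≤ N / 2) :
    ∃ a : ℕ, 1 ≤ a ∧ a + k + 1 ≤ N / 2 ∧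
      (N / 2 - k - 1) * Nat.log 2 N * (univ.filter fun x : Fin N → Bool => OddZeros x ∧ ¬ BlockRec s a k x).card ≤
        (N / 2 - k - 1) * 2 ^ (N - 1) + Nat.log 2 N * (2 * m * (k + r)) * 2 ^ (N - 1) := by
  set α := N / 2 - k - 1 with hαdef
  set L := Nat.log 2 N with hLdef
  have hα : 1 ≤ α := by omega
  set A : Finset ℕ := Finset.Icc 1 α with hAdef
  have hAcard : A.card = α := by rw [hAdef, Nat.card_Icc]; omega
  have hAne : A.Nonempty := ⟨1, by rw [hAdef, Finset.mem_Icc]; omega⟩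
  set NC : Finset (Fin N → Bool) :=
    univ.filter fun x => OddZeros x ∧ ¬ Coverable m r (dev (pad P s) x) with hNCdef
  have hNC : L * NC.card ≤ 2 ^ (N - 1) := hF
  have hper : ∀ x : Fin N → Bool,
      (A.filter fun a => OddZeros x ∧ ¬ BlockRec s a k x).card ≤ (if x ∈ NC then α else 0) + m * (k + r) := by
    intro x
    by_cases hodd : OddZeros x
    · by_cases hcov : Coverable m r (dev (pad P s) x)
      · obtain ⟨kv, hkv⟩ := hcov
        have hsub : (A.filter fun a => OddZeros x ∧ ¬ BlockRec s a k x) ⊆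
            (univ : Finset (Fin m)).biUnion fun t => Finset.Icc (kv t + 1 - k) (kv t + r) := by
          intro a ha
          rw [mem_filter] at ha
          obtain ⟨haA, -, hBad⟩ := ha
          rw [hAdef, Finset.mem_Icc] at haA
          unfold BlockRec at hBad
          push Not at hBad
          obtain ⟨j, haj, hjk, hne⟩ := hBad
          obtain ⟨t, ht1, ht2⟩ := hkv j ((hdev x j (by omega) (by omega)).2 hne)
          rw [mem_biUnion]
          refine ⟨t, mem_univ _, ?_⟩
          rw [Finset.mem_Icc]
          constructor <;> omega
        calc (A.filter fun a => OddZeros x ∧ ¬ BlockRec s a k x).card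
            ≤ ((univ : Finset (Fin m)).biUnion fun t => Finset.Icc (kv t + 1 - k) (kv t + r)).card := card_le_card hsub
          _ ≤ ∑ t, (Finset.Icc (kv t + 1 - k) (kv t + r)).card := card_biUnion_le
          _ ≤ ∑ _t : Fin m, (k + r) := sum_le_sum fun t _ => by rw [Nat.card_Icc]; omega
          _ = m * (k + r) := by simp
          _ ≤ _ := Nat.le_add_left _ _
      · have hx : x ∈ NC := by rw [hNCdef, mem_filter]; exact ⟨mem_univ _, hodd, hcov⟩
        rw [if_pos hx]
        calc (A.filter fun a => OddZeros x ∧ ¬ BlockRec s a k x).card ≤ A.card := card_filter_le _ _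
          _ = α := hAcard
          _ ≤ α + m * (k + r) := Nat.le_add_right _ _
    · have h0 : (A.filter fun a => OddZeros x ∧ ¬ BlockRec s a k x) = ∅ := by
        rw [Finset.filter_eq_empty_iff]
        intro a _ h
        exact hodd h.1
      rw [h0, card_empty]
      exact Nat.zero_le _
  have hdc := Finset.sum_card_bipartiteAbove_eq_sum_card_bipartiteBelow (s := A) (t := (univ : Finset (Fin N → Bool)))
    (r := fun a x => OddZeros x ∧ ¬ BlockRec s a k x)
  simp only [Finset.bipartiteAbove, Finset.bipartiteBelow] at hdc
  have hcardU : (univ : Finset (Fin N → Bool)).card = 2 ^ N := by simp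
  have htot : ∑ a ∈ A, (univ.filter fun x : Fin N → Bool => OddZeros x ∧ ¬ BlockRec s a k x).card ≤
      α * NC.card + 2 ^ N * (m * (k + r)) := by
    rw [hdc]
    calc ∑ x : Fin N → Bool, (A.filter fun a => OddZeros x ∧ ¬ BlockRec s a k x).card
        ≤ ∑ x : Fin N → Bool, ((if x ∈ NC then α else 0) + m * (k + r)) := sum_le_sum fun x _ => hper x
      _ = α * NC.card + 2 ^ N * (m * (k + r)) := by
        rw [sum_add_distrib, sum_const, smul_eq_mul, hcardU, Finset.sum_ite_mem, univ_inter, sum_const, smul_eq_mul,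
          Nat.mul_comm]
  obtain ⟨a, haA, ha⟩ := Finset.exists_le_of_sum_le hAne (f := fun a =>
      α * (univ.filter fun x : Fin N → Bool => OddZeros x ∧ ¬ BlockRec s a k x).card)
    (g := fun _ => ∑ a' ∈ A, (univ.filter fun x : Fin N → Bool => OddZeros x ∧ ¬ BlockRec s a' k x).card)
    (by rw [← mul_sum, sum_const, smul_eq_mul, hAcard])
  rw [hAdef, Finset.mem_Icc] at haA
  refine ⟨a, haA.1, by omega, ?_⟩
  have hN1 : 2 ^ N = 2 * 2 ^ (N - 1) := by
    conv_lhs => rw [show N = (N - 1) + 1 by omega]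
    rw [pow_succ]; ring
  have hmain : α * (univ.filter fun x : Fin N → Bool => OddZeros x ∧ ¬ BlockRec s a k x).card ≤
      α * NC.card + 2 ^ N * (m * (k + r)) := le_trans ha htot
  calc α * L * (univ.filter fun x : Fin N → Bool => OddZeros x ∧ ¬ BlockRec s a k x).card
      = L * (α * (univ.filter fun x : Fin N → Bool => OddZeros x ∧ ¬ BlockRec s a k x).card) := by ring
    _ ≤ L * (α * NC.card + 2 ^ N * (m * (k + r))) := Nat.mul_le_mul_left _ hmain
    _ = α * (L * NC.card) + L * (2 * m * (k + r)) * 2 ^ (N - 1) := by rw [hN1]; ring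
    _ ≤ α * 2 ^ (N - 1) + L * (2 * m * (k + r)) * 2 ^ (N - 1) := Nat.add_le_add_right (Nat.mul_le_mul_left _ hNC) _

/-- **E1 transferred**: a family (indexed by `n`) agreeing with the antipodal pointer on the first half `[1, n/2)` has no
cheap `((log₂ n)^a, (log₂ n)^a)`-few-locus normal form at any gauge level (the tree composition verbatim). -/
theorem not_polylogLocal_of_agree (Pf : (n : ℕ) → Fin n → CubeFn (ZMod 3) n)
    (hagree : ∀ (n : ℕ) (j : Fin n), 1 ≤ j.val → j.val < n / 2 → Pf n j = apStrat j) (a e : ℕ) :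
    ∃ n₀ : ℕ, ∀ n ≥ n₀, ¬ StabFew ((Nat.log 2 n) ^ a) ((Nat.log 2 n) ^ a) e (Pf n) := by
  set K : ℕ := 72 * 279936 + 40 with hKdef
  obtain ⟨n₀, hn₀⟩ := eventually_polylog K (2 * a + 2 * e)
  refine ⟨n₀, fun n hn hStab => ?_⟩
  obtain ⟨hKn, hL⟩ := hn₀ n hn
  obtain ⟨s, hs, hF⟩ := hStab
  set L := Nat.log 2 n with hLdef
  set M := L ^ a with hMdef
  set k : ℕ := 3456 * (8 * L ^ e + 1) ^ 2 with hkdef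
  have hL1 : 1 ≤ L := le_trans (by norm_num) hL
  have hM1 : 1 ≤ M := Nat.one_le_pow _ _ hL1
  have hLe : 1 ≤ L ^ e := Nat.one_le_pow _ _ hL1
  have hk_le : k ≤ 279936 * L ^ (2 * e) := by
    have h81 : (8 * L ^ e + 1) ^ 2 ≤ 81 * (L ^ e) ^ 2 := by nlinarith
    calc k = 3456 * (8 * L ^ e + 1) ^ 2 := rfl
      _ ≤ 3456 * (81 * (L ^ e) ^ 2) := Nat.mul_le_mul_left _ h81
      _ = 279936 * L ^ (2 * e) := by ring
  have hLL : 1 ≤ L ^ (2 * e) := Nat.one_le_pow _ _ hL1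
  have hcar : ((32 * M + 40) * 279936 + 32 * (M * M) + 8) * L ^ (2 * e) ≤ n / 2 := by
    have h1 : (32 * M + 40) * 279936 + 32 * (M * M) + 8 ≤ K * (M * M) := by rw [hKdef]; nlinarith
    calc ((32 * M + 40) * 279936 + 32 * (M * M) + 8) * L ^ (2 * e) ≤ K * (M * M) * L ^ (2 * e) :=
          Nat.mul_le_mul_right _ h1
      _ = K * L ^ (2 * a + 2 * e) := by rw [hMdef]; ring
      _ ≤ n / 2 := hKn
  have hside : 2 * k + 4 ≤ n / 2 ∧ 32 * M * (k + M) + k + 1 ≤ n / 2 := by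
    obtain ⟨h1, h2⟩ := side_bounds M M (L ^ (2 * e)) k hLL hk_le
    exact ⟨le_trans h1 hcar, le_trans h2 hcar⟩
  obtain ⟨hk2, hmk⟩ := hside
  have hdev : ∀ (x : Fin n → Bool) (j : Fin n), 1 ≤ j.val → j.val < n / 2 →
      (j ∈ dev (pad (Pf n) s) x ↔ rowMask s x j ≠ x (apIdx j)) := by
    intro x j hj1 hj2
    rw [← mem_dev_pad_apStrat_iff s x j]
    have hp : pad (Pf n) s j = pad (fun i : Fin n => apStrat i) s j := by
      simp only [pad, hagree n j hj1 hj2]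
    simp only [Summit.QuantumAdvantage.QuantumAdvantage.Theorems.AnchorDial.dev, mem_filter, mem_univ, true_and, hp]
  obtain ⟨b, hb1, hbk, hBad⟩ := blockSelect_of_fewLocus_agree M M k n (Pf n) s hdev hF hk2
  have hk3 : 3 ≤ k := by
    calc (3 : ℕ) ≤ 3456 * 1 := by norm_num
      _ ≤ 3456 * (8 * L ^ e + 1) ^ 2 := Nat.mul_le_mul_left _ (Nat.one_le_pow _ _ (by omega))
  have hGood := goodBound_of_blockRec n e b k s hs (le_of_eq hkdef.symm) hb1 hbk
    (fibreIdentityAt_of_block n b k hk3 hb1 hbk) (oddSliceBound_holds n)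
  set G := (univ.filter fun x : Fin n → Bool => OddZeros x ∧ BlockRec s b k x).card with hGdef
  set Bd := (univ.filter fun x : Fin n → Bool => OddZeros x ∧ ¬ BlockRec s b k x).card with hBdef
  have hn3 : 3 ≤ n := by
    have : 2 * k + 4 ≤ n := le_trans hk2 (Nat.div_le_self _ _)
    omega
  have hOdd : 2 ^ (n - 1) ≤ G + Bd := by
    calc 2 ^ (n - 1) ≤ (univ.filter fun x : Fin n → Bool => OddZeros x).card := card_odd_ge (by omega)
      _ ≤ G + Bd := by
        rw [hGdef, hBdef, ← Finset.card_union_of_disjoint]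
        · refine card_le_card fun x hx => ?_
          rw [mem_filter] at hx
          rw [mem_union, mem_filter, mem_filter]
          by_cases hB : BlockRec s b k x
          · exact Or.inl ⟨hx.1, hx.2, hB⟩
          · exact Or.inr ⟨hx.1, hx.2, hB⟩
        · rw [Finset.disjoint_left]
          intro x h1 h2
          rw [mem_filter] at h1 h2
          exact h2.2.2 h1.2.2
  set A := n / 2 - k - 1 with hAdef
  have hA : 32 * M * (k + M) ≤ A := by rw [hAdef]; omega
  have hApos : 1 ≤ A := by rw [hAdef]; omega
  have hP : 0 < 2 ^ (n - 1) := Nat.two_pow_pos _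
  have hBd16 : 16 * (A * L * Bd) ≤ A * L * 2 ^ (n - 1) + 2 * (A * L * 2 ^ (n - 1)) := by
    have h1 : 16 * (A * 2 ^ (n - 1)) ≤ A * L * 2 ^ (n - 1) := by
      calc 16 * (A * 2 ^ (n - 1)) = A * 16 * 2 ^ (n - 1) := by ring
        _ ≤ A * L * 2 ^ (n - 1) := Nat.mul_le_mul_right _ (Nat.mul_le_mul_left _ hL)
    have h2 : 16 * (L * (2 * M * (k + M)) * 2 ^ (n - 1)) ≤ 2 * (A * L * 2 ^ (n - 1)) := by
      have : 16 * (2 * M * (k + M)) ≤ A := by nlinarith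
      calc 16 * (L * (2 * M * (k + M)) * 2 ^ (n - 1)) = (16 * (2 * M * (k + M))) * L * 2 ^ (n - 1) := by ring
        _ ≤ A * L * 2 ^ (n - 1) := Nat.mul_le_mul_right _ (Nat.mul_le_mul_right _ this)
        _ ≤ 2 * (A * L * 2 ^ (n - 1)) := by omega
    calc 16 * (A * L * Bd) ≤ 16 * (A * 2 ^ (n - 1) + L * (2 * M * (k + M)) * 2 ^ (n - 1)) :=
          Nat.mul_le_mul_left _ hBad
      _ = 16 * (A * 2 ^ (n - 1)) + 16 * (L * (2 * M * (k + M)) * 2 ^ (n - 1)) := by ring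
      _ ≤ _ := Nat.add_le_add h1 h2
  have hBd : 16 * Bd ≤ 3 * 2 ^ (n - 1) := by
    have hAL : 0 < A * L := Nat.mul_pos (by omega) (by omega)
    have : A * L * (16 * Bd) ≤ A * L * (3 * 2 ^ (n - 1)) := by
      calc A * L * (16 * Bd) = 16 * (A * L * Bd) := by ring
        _ ≤ A * L * 2 ^ (n - 1) + 2 * (A * L * 2 ^ (n - 1)) := hBd16
        _ = A * L * (3 * 2 ^ (n - 1)) := by ring
    exact Nat.le_of_mul_le_mul_left this hAL
  have hG : 16 * G ≤ 12 * 2 ^ (n - 1) := by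
    have h2n : 2 ^ n = 2 ^ (n - 1) * 2 := by
      conv_lhs => rw [show n = (n - 1) + 1 by omega]
      exact pow_succ 2 (n - 1)
    have h8 : 8 * G ≤ 3 * (2 ^ (n - 1) * 2) := h2n ▸ hGood
    omega
  have := Nat.mul_le_mul_left 16 hOdd
  omega

/-- width-`0` (POINT) form at scale `(log₂ n)^a`: the form `DenseGenericLoss3` negates. -/
theorem not_polylogSparse_of_agree (Pf : (n : ℕ) → Fin n → CubeFn (ZMod 3) n)
    (hagree : ∀ (n : ℕ) (j : Fin n), 1 ≤ j.val → j.val < n / 2 → Pf n j = apStrat j) (a e : ℕ) :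
    ∃ n₀ : ℕ, ∀ n ≥ n₀, ¬ StabFew ((Nat.log 2 n) ^ a) 0 e (Pf n) := by
  obtain ⟨n₀, hn₀⟩ := not_polylogLocal_of_agree Pf hagree a e
  refine ⟨max n₀ 2, fun n hn h => hn₀ n (le_of_max_le_left hn) ?_⟩
  exact stabFew_mono_mr le_rfl (one_le_logpow (le_of_max_le_right hn) a) (Nat.zero_le _) h

end Agree

section HalfCounter
variable {N : ℕ}

/-- the linear form `Σ_{odd i} x_i` over `𝔽₃`. -/
def lodd : CubeFn (ZMod 3) N := ∑ i ∈ (univ : Finset (Fin N)).filter (fun i => i.val % 2 = 1), mono (ZMod 3) {i}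

/-- ResponseDialD helper `lodd_mem` (decomp-qadv land package; see the module docstring). -/
theorem lodd_mem : (lodd : CubeFn (ZMod 3) N) ∈ lowDeg (ZMod 3) N 1 :=
  Submodule.sum_mem _ fun _ _ => mono_mem_lowDeg (Finset.card_singleton _).le

/-- ResponseDialD helper `lodd_apply` (decomp-qadv land package; see the module docstring). -/
theorem lodd_apply (x : Fin N → Bool) :
    (lodd : CubeFn (ZMod 3) N) x = (((univ : Finset (Fin N)).filter fun i => i.val % 2 = 1 ∧ x i = true).card : ZMod 3) := by
  unfold lodd
  rw [Finset.sum_apply, ← filter_filter, Finset.card_filter, Nat.cast_sum]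
  refine sum_congr rfl fun i _ => ?_
  rw [mono_singleton_apply]
  by_cases h : x i = true <;> simp [h]

/-- the COMMON COUNTER `q(x) = [#{odd i : x_i} ≡ 0 (mod 3)]` as a degree-2 polynomial. -/
def qpoly : CubeFn (ZMod 3) N := indP lodd 0

/-- ResponseDialD helper `qpoly_mem` (decomp-qadv land package; see the module docstring). -/
theorem qpoly_mem : (qpoly : CubeFn (ZMod 3) N) ∈ lowDeg (ZMod 3) N 2 := indP_mem lodd_mem 0

/-- the counter bit. -/
def qbit (x : Fin N → Bool) : Bool := decide ((lodd : CubeFn (ZMod 3) N) x = 0)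

/-- ResponseDialD helper `qpoly_apply` (decomp-qadv land package; see the module docstring). -/
theorem qpoly_apply (x : Fin N → Bool) : (qpoly : CubeFn (ZMod 3) N) x = if qbit x then 1 else 0 := by
  unfold qpoly qbit; rw [indP_apply]; by_cases h : (lodd : CubeFn (ZMod 3) N) x = 0 <;> simp [h]

/-- **THE HALF-COUNTER FAMILY**: antipodal pointer on `[1, N/2)`, canonical guess toggled by the common counter elsewhere. -/
def hcStrat (j : Fin N) : CubeFn (ZMod 3) N :=
  if 1 ≤ j.val ∧ j.val < N / 2 then apStrat j else xorP (tPoly j) qpoly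

/-- ResponseDialD helper `hcStrat_mem` (decomp-qadv land package; see the module docstring). -/
theorem hcStrat_mem (j : Fin N) : hcStrat j ∈ lowDeg (ZMod 3) N 4 := by
  unfold hcStrat
  split_ifs
  · exact lowDeg_mono (by norm_num) (apStrat_mem j)
  · have h : xorP (tPoly j) qpoly ∈ lowDeg (ZMod 3) N (2 + 2) := xorP_mem (tPoly_mem j) qpoly_mem
    exact lowDeg_mono (by norm_num) h

/-- ResponseDialD helper `hcStrat_agree` (decomp-qadv land package; see the module docstring). -/
theorem hcStrat_agree (j : Fin N) (h1 : 1 ≤ j.val) (h2 : j.val < N / 2) : hcStrat j = apStrat j := by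
  unfold hcStrat; rw [if_pos ⟨h1, h2⟩]

/-- off the first half, position `j` deviates iff the counter bit is set. -/
theorem mem_dev_hcStrat_iff (x : Fin N → Bool) (j : Fin N) (hj : ¬ (1 ≤ j.val ∧ j.val < N / 2)) :
    j ∈ dev (fun i : Fin N => hcStrat i) x ↔ qbit x = true := by
  have happ : hcStrat j x = if xor (tGuess x j) (qbit x) then 1 else 0 := by
    unfold hcStrat; rw [if_neg hj]; exact xorP_apply_bool _ _ x _ _ (tPoly_apply j x) (qpoly_apply x)
  simp only [Summit.QuantumAdvantage.QuantumAdvantage.Theorems.AnchorDial.dev, mem_filter, mem_univ, true_and, happ]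
  generalize tGuess x j = t; generalize qbit x = q
  cases t <;> cases q <;> decide

/-- **(a) CERTIFIED DENSE**: the half-counter family is not cheaply `(log₂ n)^a`-point-sparsifiable, at any level. -/
theorem hcStrat_not_polylogSparse (a e : ℕ) :
    ∃ n₀ : ℕ, ∀ n ≥ n₀, ¬ StabFew ((Nat.log 2 n) ^ a) 0 e (fun j : Fin n => hcStrat j) := by
  have hag : ∀ (n : ℕ) (j : Fin n), 1 ≤ j.val → j.val < n / 2 →
      (fun (n : ℕ) (j : Fin n) => (hcStrat j : CubeFn (ZMod 3) n)) n j = apStrat j :=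
    fun n j h1 h2 => hcStrat_agree j h1 h2
  obtain ⟨n₀, hn₀⟩ := not_polylogSparse_of_agree (fun (n : ℕ) (j : Fin n) => (hcStrat j : CubeFn (ZMod 3) n)) hag a e
  exact ⟨n₀, fun n hn => hn₀ n hn⟩

/-- hence it inhabits `DenseGenericLoss3`'s hypothesis class at every scale (degree `4 ≤ (log₂ n)^c`, `c ≥ 1`). -/
theorem hcStrat_in_dense_class (a c : ℕ) (hc : 1 ≤ c) :
    ∃ n₀ : ℕ, ∀ n ≥ n₀, (∀ i : Fin n, hcStrat i ∈ lowDeg (ZMod 3) n ((Nat.log 2 n) ^ c)) ∧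
      ¬ StabFew ((Nat.log 2 n) ^ a) 0 (c + 1) (fun j : Fin n => hcStrat j) := by
  obtain ⟨n₀, hn₀⟩ := hcStrat_not_polylogSparse a (c + 1)
  refine ⟨max n₀ 16, fun n hn => ⟨fun i => ?_, hn₀ n (le_trans (le_max_left _ _) hn)⟩⟩
  have h16 : 2 ^ 4 ≤ n := le_trans (le_max_right _ _) hn
  have hL : 4 ≤ Nat.log 2 n := Nat.le_log_of_pow_le (by norm_num) h16
  have h4 : 4 ≤ (Nat.log 2 n) ^ c :=
    calc 4 ≤ Nat.log 2 n := hL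
      _ = (Nat.log 2 n) ^ 1 := (pow_one _).symm
      _ ≤ (Nat.log 2 n) ^ c := Nat.pow_le_pow_right (by omega) hc
  exact lowDeg_mono h4 (hcStrat_mem i)

/-- **the residual's first rung** (OPEN): the half-counter family loses a polynomial fraction. -/
def HalfCounterLoss3 : Prop :=
  ∃ C n₀ : ℕ, ∀ n ≥ n₀,
    ((univ.filter fun x : Fin n → Bool => OddZeros x ∧ Rel x (fun i => decide (hcStrat i x = 1))).card : ℝ)
      ≤ (1 - 1 / (n : ℝ) ^ C) * (2 : ℝ) ^ (n - 1)

/-- `DenseGenericLoss3 ⟹ HalfCounterLoss3` (at `a = 1`, `c = 1`): the target speaks about the family. -/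
theorem halfCounterLoss3_of_dense (hD : DenseGenericLoss3) : HalfCounterLoss3 := by
  obtain ⟨a, C, h⟩ := hD
  obtain ⟨n₁, hn₁⟩ := h 1
  obtain ⟨n₂, hn₂⟩ := hcStrat_in_dense_class a 1 le_rfl
  refine ⟨C, max n₁ n₂, fun n hn => ?_⟩
  obtain ⟨hdeg, hgen⟩ := hn₂ n (le_trans (le_max_right _ _) hn)
  exact hn₁ n (le_trans (le_max_left _ _) hn) _ hdeg hgen

end HalfCounter



end Summit.QuantumAdvantage.QuantumAdvantage.Theorems.ResponseDial
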